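import Literature.Dynamics.TransferOperators.MayerTransferOperatorBounds
import Mathlib.Analysis.SumIntegralComparisons
import HarnessLib

/-!
# The second-order Euler–Maclaurin (trapezoid) remainder of the Hurwitz zeta function

Companion file to `MayerTransferOperator.lean` / `MayerTransferOperatorBounds.lean` (the Hurwitz
zeta function `ζ(σ, b) = hurwitzZetaC σ b` with complex parameter, `Re b > 0`, continued to `Re σ > 0`
by subtracting `∫₀^∞ (x+b)^{-σ} dx` termwise). Here we go one order further in Euler–Maclaurin:

  `R(σ, b) := ∑_{n ≥ 0} [½((n+b)^{-σ} + (n+b+1)^{-σ}) - ((n+b+1)^{1-σ} - (n+b)^{1-σ})/(1-σ)]`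

(`hurwitzR`; each bracket `hurwitzTrapTerm σ b n` is the error of the trapezoid rule for
`x ↦ (x+b)^{-σ}` on `[n, n+1]`). This series converges absolutely for `Re σ > -1` and

* `R(σ, b) = ζ(σ, b) - b^{1-σ}/(σ-1) - b^{-σ}/2` for `Re σ > 0` (`hurwitzR_eq_hurwitzZetaC_sub`),
* `R(σ, b) = ∑_{n ≥ 0} (n+b)^{-σ} - b^{1-σ}/(σ-1) - b^{-σ}/2` for `Re σ > 1` (`hurwitzR_eq_tsum_sub`),
* `‖R(σ, b)‖ ≤ K(σ) ∑ₙ (n + Re b)^{-(Re σ+2)}`, `K(σ) = ‖σ‖‖σ+1‖e^{π|Im σ|/2}/2` (`norm_hurwitzR_le_tsum`),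
  hence `R(σ, b) = O((Re b)^{-(Re σ/2+1)})` uniformly on `{Re b ≥ x₀}` (`norm_hurwitzR_le_decay`,
  `norm_hurwitzR_le_uniform` — the latter uniform for `σ` in a box, for M-tests in `σ`), and, by
  integral comparison, the sharp order `R(σ, b) = O((Re b)^{-(Re σ+1)})` on `{Re b ≥ x₀}` for all
  `Re σ > -1` (`norm_hurwitzR_le_decay_sharp`),
* `b ↦ R(σ, b)` is holomorphic on `{Re b > 0}` (`differentiableOn_hurwitzR_right`) and
  `σ ↦ R(σ, b)` is holomorphic at every `σ₀` with `Re σ₀ > 0`, `σ₀ ≠ 1`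
  (`differentiableAt_hurwitzR_left`).

The point of the extra order: `R(σ, m z)` is summable over `m ≥ 1` already for `Re σ > 0`, which
is what the continuation of Zagier's period function `∑_{m,n}(mz+n)^{-σ}` to the critical strip
needs (`ZagierPsi.lean`). The trapezoid estimate `norm_trapBracket_le` is proved with three
applications of the mean value inequality on `[0,1]` (no integrals), like `norm_hurwitzBracket_le`.
All statements are standard ([folklore]; cf. Whittaker–Watson §13.2 for Hurwitz's function).
-/

noncomputable section

open Complex Metric Set Filter Topology Real

namespace Literature.Dynamics.TransferOperators

/-! ### Definitions -/

/-- The `n`-th **trapezoid bracket** `½((n+b)^{-σ} + (n+b+1)^{-σ}) - ((n+b+1)^{1-σ} - (n+b)^{1-σ})/(1-σ)`,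
i.e. `½(h(n) + h(n+1)) - ∫ₙ^{n+1} h` for `h(x) = (x+b)^{-σ}` (the error of the trapezoid rule on
`[n, n+1]`); it is `O(|σ(σ+1)| (n + Re b)^{-Re σ - 2})`. [folklore] -/
def hurwitzTrapTerm (σ b : ℂ) (n : ℕ) : ℂ :=
  (((n : ℂ) + b) ^ (-σ) + ((n : ℂ) + b + 1) ^ (-σ)) / 2 -
    (((n : ℂ) + b + 1) ^ (1 - σ) - ((n : ℂ) + b) ^ (1 - σ)) / (1 - σ)

/-- The **second-order Euler–Maclaurin remainder** of the Hurwitz zeta function with complex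
parameter: `R(σ, b) = ∑_{n ≥ 0} hurwitzTrapTerm σ b n`, absolutely convergent for `Re σ > -1`,
`Re b > 0` (`σ ≠ 1`). For `Re σ > 1` it equals `∑_{n≥0} (n+b)^{-σ} - b^{1-σ}/(σ-1) - b^{-σ}/2`
(`hurwitzR_eq_tsum_sub`), and for `Re σ > 0` it equals `ζ(σ, b) - b^{1-σ}/(σ-1) - b^{-σ}/2` with
`ζ(σ, b) = hurwitzZetaC σ b` (`hurwitzR_eq_hurwitzZetaC_sub`); it is `O((Re b)^{-Re σ - 1})`
(`norm_hurwitzR_le_decay_sharp`), one order better than `ζ(σ,b) - b^{1-σ}/(σ-1) = O((Re b)^{-Re σ})`.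
[folklore] -/
def hurwitzR (σ b : ℂ) : ℂ :=
  ∑' n : ℕ, hurwitzTrapTerm σ b n

/-- Unfolding lemma for `hurwitzR`. [folklore] -/
theorem hurwitzR_def (σ b : ℂ) : hurwitzR σ b = ∑' n : ℕ, hurwitzTrapTerm σ b n := rfl

/-- The trapezoid bracket is the bracket of `hurwitzZetaC` minus half the first difference of
`(n+b)^{-σ}`. [folklore] -/
theorem hurwitzTrapTerm_eq_hurwitzZetaCTerm_sub (σ b : ℂ) (n : ℕ) :
    hurwitzTrapTerm σ b n =
      hurwitzZetaCTerm σ b n - (((n : ℂ) + b) ^ (-σ) - ((n : ℂ) + b + 1) ^ (-σ)) / 2 := by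
  simp only [hurwitzTrapTerm, hurwitzZetaCTerm]
  ring

/-- Shifting the parameter by one shifts the index. [folklore] -/
theorem hurwitzTrapTerm_succ (σ b : ℂ) (n : ℕ) :
    hurwitzTrapTerm σ b (n + 1) = hurwitzTrapTerm σ (b + 1) n := by
  simp only [hurwitzTrapTerm, Nat.cast_succ]
  ring_nf

/-! ### The trapezoid estimate -/

/-- The constant `K(σ) = ‖σ‖ ‖σ+1‖ e^{π |Im σ|/2} / 2` of the trapezoid estimate. [folklore] -/
def trapConst (σ : ℂ) : ℝ := ‖σ‖ * ‖σ + 1‖ * Real.exp (π / 2 * |σ.im|) / 2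

/-- `K(σ) ≥ 0`. [folklore] -/
theorem trapConst_nonneg (σ : ℂ) : 0 ≤ trapConst σ := by
  unfold trapConst; positivity

/-- Monotone bound for `K(σ)`: if `‖σ‖ ≤ S` and `|Im σ| ≤ T` then `K(σ) ≤ S (S+1) e^{π T/2} / 2`.
[folklore] -/
theorem trapConst_le {σ : ℂ} {S T : ℝ} (hS : ‖σ‖ ≤ S) (hT : |σ.im| ≤ T) :
    trapConst σ ≤ S * (S + 1) * Real.exp (π / 2 * T) / 2 := by
  unfold trapConst
  have h1 : ‖σ + 1‖ ≤ S + 1 := (norm_add_le _ _).trans (by rw [norm_one]; linarith)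
  have h2 : Real.exp (π / 2 * |σ.im|) ≤ Real.exp (π / 2 * T) :=
    Real.exp_le_exp.mpr (mul_le_mul_of_nonneg_left hT (by positivity))
  have hS0 : 0 ≤ S := (norm_nonneg _).trans hS
  gcongr

/-- **The trapezoid estimate.** For `σ ≠ 1` with `Re σ ≥ -2` and `Re c > 0`,
`‖½(c^{-σ} + (c+1)^{-σ}) - ((c+1)^{1-σ} - c^{1-σ})/(1-σ)‖ ≤ K(σ) (Re c)^{-(Re σ+2)}`,
`K(σ) = ‖σ‖‖σ+1‖e^{π|Im σ|/2}/2`. With `G(u) = (c+u)^{1-σ}/(1-σ)`, `h = G'`, the bracket is half of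
`φ(1)` for `φ(u) = u (h(0) + h(u)) - 2 (G(u) - G(0))`, whose derivative
`χ(u) = h(0) - h(u) + u h'(u)` vanishes at `0` and has derivative `u h''(u)`; three applications of
the mean value inequality on `[0, 1]` (no integrals). [folklore] -/
theorem norm_trapBracket_le {σ c : ℂ} (hσ1 : σ ≠ 1) (hσ : -2 ≤ σ.re) (hc : 0 < c.re) :
    ‖(c ^ (-σ) + (c + 1) ^ (-σ)) / 2 - ((c + 1) ^ (1 - σ) - c ^ (1 - σ)) / (1 - σ)‖ ≤
      trapConst σ * c.re ^ (-(σ.re + 2)) := by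
  have h1s : (1 - σ) ≠ 0 := sub_ne_zero.mpr hσ1.symm
  set M : ℝ := ‖σ‖ * ‖σ + 1‖ * Real.exp (π / 2 * |σ.im|) * c.re ^ (-(σ.re + 2)) with hM
  -- the functions of the real variable `u`
  set G : ℝ → ℂ := fun u => (c + u) ^ (1 - σ) / (1 - σ) with hG
  set h : ℝ → ℂ := fun u => (c + u) ^ (-σ) with hh
  set h' : ℝ → ℂ := fun u => -σ * (c + u) ^ (-σ - 1) with hh'
  set h'' : ℝ → ℂ := fun u => σ * (σ + 1) * (c + u) ^ (-σ - 2) with hh''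
  have hre : ∀ u : ℝ, 0 ≤ u → 0 < (c + u).re := fun u hu => by
    simp only [add_re, ofReal_re]; linarith
  have hslit : ∀ u : ℝ, 0 ≤ u → (c + (u : ℂ)) ∈ slitPlane := fun u hu =>
    mem_slitPlane_iff.mpr (Or.inl (hre u hu))
  have hpow : ∀ (p : ℂ) (u : ℝ), 0 ≤ u →
      HasDerivAt (fun y : ℝ => (c + (y : ℂ)) ^ p) (p * (c + u) ^ (p - 1)) u := fun p u hu => by
    have h1 := ((hasDerivAt_id ((u : ℝ) : ℂ)).const_add c).cpow_const (c := p) (hslit u hu)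
    simpa using h1.comp_ofReal
  -- derivatives
  have hGd : ∀ u : ℝ, 0 ≤ u → HasDerivAt G (h u) u := fun u hu => by
    refine ((hpow (1 - σ) u hu).div_const (1 - σ)).congr_deriv ?_
    rw [sub_sub_cancel_left, mul_comm, mul_div_assoc, div_self h1s, mul_one, hh]
  have hhd : ∀ u : ℝ, 0 ≤ u → HasDerivAt h (h' u) u := fun u hu => by
    refine (hpow (-σ) u hu).congr_deriv ?_
    simp only [hh']
  have hh'd : ∀ u : ℝ, 0 ≤ u → HasDerivAt h' (h'' u) u := fun u hu => by
    refine ((hpow (-σ - 1) u hu).const_mul (-σ)).congr_deriv ?_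
    simp only [hh'']
    rw [show (-σ - 1 - 1 : ℂ) = -σ - 2 by ring]
    ring
  -- bound on `h''`
  have hh''b : ∀ u : ℝ, 0 ≤ u → ‖h'' u‖ ≤ M := fun u hu => by
    rw [hh'', norm_mul, norm_mul, hM, mul_assoc (‖σ‖ * ‖σ + 1‖)]
    refine mul_le_mul_of_nonneg_left ?_ (by positivity)
    have hw : (-σ - 2).re ≤ 0 := by simp only [sub_re, neg_re, re_ofNat]; linarith
    refine (norm_cpow_le_re_rpow_of_re_pos (hre u hu) hw).trans ?_
    have him : |(-σ - 2).im| = |σ.im| := by simp [abs_neg]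
    rw [him, mul_comm]
    refine mul_le_mul_of_nonneg_left ?_ (Real.exp_pos _).le
    have hexp : (-σ - 2).re = -(σ.re + 2) := by simp only [sub_re, neg_re, re_ofNat]; ring
    rw [hexp]
    refine Real.rpow_le_rpow_of_nonpos hc ?_ (by linarith)
    simp only [add_re, ofReal_re]; linarith
  have hM0 : 0 ≤ M := (norm_nonneg _).trans (hh''b 0 le_rfl)
  -- `χ(u) = h 0 - h u + u • h' u` has derivative `u • h'' u`, bounded by `M` on `[0, 1]`
  set χ : ℝ → ℂ := fun u => h 0 - h u + u • h' u with hχ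
  have hχd : ∀ u : ℝ, 0 ≤ u → HasDerivAt χ (u • h'' u) u := fun u hu => by
    have hd := ((hhd u hu).const_sub (h 0)).add ((hasDerivAt_id u).smul (hh'd u hu))
    refine hd.congr_deriv ?_
    simp only [id_eq, one_smul]
    abel
  have hχb : ∀ u ∈ Icc (0 : ℝ) 1, ‖χ u‖ ≤ M := by
    intro u hu
    have key := norm_image_sub_le_of_norm_deriv_le_segment' (f := χ) (f' := fun u => u • h'' u)
      (C := M) (a := 0) (b := 1) (fun x hx => (hχd x hx.1).hasDerivWithinAt) (fun x hx => ?_) u hu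
    · have hχ0 : χ 0 = 0 := by simp [hχ]
      rw [hχ0, sub_zero, sub_zero] at key
      exact key.trans (mul_le_of_le_one_right hM0 hu.2)
    · rw [norm_smul, Real.norm_eq_abs, abs_of_nonneg hx.1]
      exact (mul_le_mul hx.2.le (hh''b x hx.1) (norm_nonneg _) zero_le_one).trans_eq (one_mul M)
  -- `φ(u) = u • (h 0 + h u) - 2 * (G u - G 0)` has derivative `χ u`
  set φ : ℝ → ℂ := fun u => u • (h 0 + h u) - 2 * (G u - G 0) with hφ
  have hφd : ∀ u : ℝ, 0 ≤ u → HasDerivAt φ (χ u) u := fun u hu => by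
    have hd := ((hasDerivAt_id u).smul ((hhd u hu).const_add (h 0))).sub
      (((hGd u hu).sub_const (G 0)).const_mul (2 : ℂ))
    refine hd.congr_deriv ?_
    simp only [id_eq, one_smul, hχ]
    ring
  have hstep : ‖φ 1 - φ 0‖ ≤ M := by
    have key := norm_image_sub_le_of_norm_deriv_le_segment_01' (f := φ) (f' := χ)
      (fun x hx => (hφd x hx.1).hasDerivWithinAt) (fun x hx => hχb x (Ico_subset_Icc_self hx))
    simpa using key
  -- identify the bracket with `φ 1 / 2`
  have hφ1 : φ 1 - φ 0 = 2 * ((c ^ (-σ) + (c + 1) ^ (-σ)) / 2 -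
      ((c + 1) ^ (1 - σ) - c ^ (1 - σ)) / (1 - σ)) := by
    simp only [hφ, hG, hh, ofReal_one, ofReal_zero, add_zero, one_smul, zero_smul, sub_self,
      mul_zero, sub_zero]
    field_simp
  rw [hφ1, norm_mul, Complex.norm_two] at hstep
  have : trapConst σ * c.re ^ (-(σ.re + 2)) = M / 2 := by
    simp only [trapConst, hM]; ring
  rw [this]
  linarith

/-- **Term estimate**: for `σ ≠ 1`, `Re σ ≥ -2`, `Re b > 0`,
`‖hurwitzTrapTerm σ b n‖ ≤ K(σ) (n + Re b)^{-(Re σ+2)}`. [folklore] -/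
theorem norm_hurwitzTrapTerm_le {σ b : ℂ} (hσ1 : σ ≠ 1) (hσ : -2 ≤ σ.re) (hb : 0 < b.re) (n : ℕ) :
    ‖hurwitzTrapTerm σ b n‖ ≤ trapConst σ * ((n : ℝ) + b.re) ^ (-(σ.re + 2)) := by
  have hc : 0 < ((n : ℂ) + b).re := by
    simp only [add_re, natCast_re]; positivity
  have h := norm_trapBracket_le (c := (n : ℂ) + b) hσ1 hσ hc
  simp only [add_re, natCast_re] at h
  exact h

/-- Uniform term estimate on `{Re b ≥ x₀}` for `σ` in a box: if `s₁ ≤ Re σ ≤ s₂`, `‖σ‖ ≤ S`,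
`|Im σ| ≤ T`, `σ ≠ 1`, `-2 ≤ s₁` and `0 < x₀ ≤ Re b`, then
`‖hurwitzTrapTerm σ b n‖ ≤ S(S+1)e^{πT/2}/2 · ((n+x₀)^{-(s₁+2)} + (n+x₀)^{-(s₂+2)})`. [folklore] -/
theorem norm_hurwitzTrapTerm_le_uniform {σ b : ℂ} {s₁ s₂ S T x₀ : ℝ} (hσ1 : σ ≠ 1)
    (h₁ : s₁ ≤ σ.re) (h₂ : σ.re ≤ s₂) (hs₁ : -2 ≤ s₁) (hS : ‖σ‖ ≤ S) (hT : |σ.im| ≤ T)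
    (hx₀ : 0 < x₀) (hb : x₀ ≤ b.re) (n : ℕ) :
    ‖hurwitzTrapTerm σ b n‖ ≤ S * (S + 1) * Real.exp (π / 2 * T) / 2 *
      (((n : ℝ) + x₀) ^ (-(s₁ + 2)) + ((n : ℝ) + x₀) ^ (-(s₂ + 2))) := by
  have hb0 : 0 < b.re := hx₀.trans_le hb
  refine (norm_hurwitzTrapTerm_le hσ1 (hs₁.trans h₁) hb0 n).trans ?_
  have hK := trapConst_le hS hT
  have hK0 := trapConst_nonneg σ
  have hy : 0 < (n : ℝ) + b.re := by positivity
  have hy₀ : 0 < (n : ℝ) + x₀ := by positivity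
  -- first replace `Re b` by `x₀` (the exponent is negative)
  have hmono : ((n : ℝ) + b.re) ^ (-(σ.re + 2)) ≤ ((n : ℝ) + x₀) ^ (-(σ.re + 2)) :=
    Real.rpow_le_rpow_of_nonpos hy₀ (by linarith) (by linarith)
  -- then sandwich the exponent
  have htwo : ((n : ℝ) + x₀) ^ (-(σ.re + 2)) ≤
      ((n : ℝ) + x₀) ^ (-(s₁ + 2)) + ((n : ℝ) + x₀) ^ (-(s₂ + 2)) := by
    rcases le_or_gt 1 ((n : ℝ) + x₀) with h1 | h1
    · have : ((n : ℝ) + x₀) ^ (-(σ.re + 2)) ≤ ((n : ℝ) + x₀) ^ (-(s₁ + 2)) :=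
        Real.rpow_le_rpow_of_exponent_le h1 (by linarith)
      linarith [Real.rpow_nonneg hy₀.le (-(s₂ + 2))]
    · have : ((n : ℝ) + x₀) ^ (-(σ.re + 2)) ≤ ((n : ℝ) + x₀) ^ (-(s₂ + 2)) :=
        Real.rpow_le_rpow_of_exponent_ge hy₀ h1.le (by linarith)
      linarith [Real.rpow_nonneg hy₀.le (-(s₁ + 2))]
  calc trapConst σ * ((n : ℝ) + b.re) ^ (-(σ.re + 2))
      ≤ trapConst σ * (((n : ℝ) + x₀) ^ (-(s₁ + 2)) + ((n : ℝ) + x₀) ^ (-(s₂ + 2))) :=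
        mul_le_mul_of_nonneg_left (hmono.trans htwo) hK0
    _ ≤ _ := mul_le_mul_of_nonneg_right hK (by positivity)

/-- The comparison series `∑ₙ (n + x)^{-(s+2)}` converges for `x > 0`, `s > -1`. [folklore] -/
theorem summable_nat_add_rpow_neg_two {x s : ℝ} (hx : 0 < x) (hs : -1 < s) :
    Summable fun n : ℕ => ((n : ℝ) + x) ^ (-(s + 2)) := by
  have h := summable_nat_add_rpow_neg (σ := s + 1) hx (by linarith)
  refine h.congr fun n => ?_
  ring_nf

/-- **Absolute convergence** of the trapezoid series for `Re σ > -1`, `σ ≠ 1`, `Re b > 0`. [folklore] -/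
theorem summable_hurwitzTrapTerm {σ b : ℂ} (hσ1 : σ ≠ 1) (hσ : -1 < σ.re) (hb : 0 < b.re) :
    Summable (hurwitzTrapTerm σ b) :=
  Summable.of_norm_bounded ((summable_nat_add_rpow_neg_two hb hσ).mul_left (trapConst σ))
    fun n => norm_hurwitzTrapTerm_le hσ1 (by linarith) hb n

/-- **Norm bound**: `‖R(σ, b)‖ ≤ K(σ) ∑ₙ (n + Re b)^{-(Re σ+2)}` (`Re σ > -1`, `σ ≠ 1`, `Re b > 0`).
[folklore] -/
theorem norm_hurwitzR_le_tsum {σ b : ℂ} (hσ1 : σ ≠ 1) (hσ : -1 < σ.re) (hb : 0 < b.re) :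
    ‖hurwitzR σ b‖ ≤ trapConst σ * ∑' n : ℕ, ((n : ℝ) + b.re) ^ (-(σ.re + 2)) := by
  rw [hurwitzR_def, ← tsum_mul_left]
  exact tsum_of_norm_bounded ((summable_nat_add_rpow_neg_two hb hσ).mul_left _).hasSum
    fun n => norm_hurwitzTrapTerm_le hσ1 (by linarith) hb n

/-! ### Powers `(n + b)^{-τ}` tend to zero -/

/-- `‖(n + b)^{-τ}‖ ≤ e^{π|Im τ|/2} (n + Re b)^{-Re τ}` for `Re b > 0`, `Re τ ≥ 0`. [folklore] -/
theorem norm_natCast_add_cpow_neg_le {b τ : ℂ} (hb : 0 < b.re) (hτ : 0 ≤ τ.re) (n : ℕ) :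
    ‖((n : ℂ) + b) ^ (-τ)‖ ≤ Real.exp (π / 2 * |τ.im|) * ((n : ℝ) + b.re) ^ (-τ.re) := by
  have hc : 0 < ((n : ℂ) + b).re := by simp only [add_re, natCast_re]; positivity
  have hw : (-τ).re ≤ 0 := by simp; linarith
  have h := norm_cpow_le_re_rpow_of_re_pos hc hw
  simp only [add_re, natCast_re, neg_re, neg_im, abs_neg] at h
  rw [mul_comm] at h
  exact h

/-- `(n + b)^{-τ} → 0` as `n → ∞`, for `Re b > 0`, `Re τ > 0`. [folklore] -/
theorem tendsto_natCast_add_cpow_neg {b τ : ℂ} (hb : 0 < b.re) (hτ : 0 < τ.re) :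
    Tendsto (fun n : ℕ => ((n : ℂ) + b) ^ (-τ)) atTop (𝓝 0) := by
  rw [tendsto_zero_iff_norm_tendsto_zero]
  have h1 : Tendsto (fun n : ℕ => ((n : ℝ) + b.re) ^ (-τ.re)) atTop (𝓝 0) := by
    have ht : Tendsto (fun n : ℕ => (n : ℝ) + b.re) atTop atTop :=
      tendsto_atTop_add_const_right _ _ tendsto_natCast_atTop_atTop
    exact (tendsto_rpow_neg_atTop hτ).comp ht
  have h2 : Tendsto (fun n : ℕ => Real.exp (π / 2 * |τ.im|) * ((n : ℝ) + b.re) ^ (-τ.re))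
      atTop (𝓝 0) := by
    simpa using h1.const_mul (Real.exp (π / 2 * |τ.im|))
  exact squeeze_zero (fun n => norm_nonneg _) (fun n => norm_natCast_add_cpow_neg_le hb hτ.le n) h2

/-! ### Relation with `hurwitzZetaC` and evaluation for `Re σ > 1` -/

/-- **`R(σ,b) = ζ(σ,b) - b^{1-σ}/(σ-1) - b^{-σ}/2`** for `Re σ > 0`, `σ ≠ 1`, `Re b > 0`. [folklore] -/
theorem hurwitzR_eq_hurwitzZetaC_sub {σ b : ℂ} (hσ1 : σ ≠ 1) (hσ : 0 < σ.re) (hb : 0 < b.re) :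
    hurwitzR σ b = hurwitzZetaC σ b - b ^ (1 - σ) / (σ - 1) - b ^ (-σ) / 2 := by
  -- the half first-difference series sums to `b^{-σ}/2`
  set a : ℕ → ℂ := fun n => ((n : ℂ) + b) ^ (-σ) with ha
  have hdiff : ∀ n, hurwitzTrapTerm σ b n = hurwitzZetaCTerm σ b n - (a n - a (n + 1)) / 2 := by
    intro n
    rw [hurwitzTrapTerm_eq_hurwitzZetaCTerm_sub]
    simp only [ha, Nat.cast_succ]
    ring_nf
  have hsumT := summable_hurwitzTrapTerm hσ1 (by linarith) hb
  have hsumZ := summable_hurwitzZetaCTerm hσ1 hσ hb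
  have hsumD : Summable fun n => (a n - a (n + 1)) / 2 := by
    have : (fun n => (a n - a (n + 1)) / 2) = fun n => hurwitzZetaCTerm σ b n - hurwitzTrapTerm σ b n := by
      funext n; rw [hdiff n]; ring
    rw [this]
    exact hsumZ.sub hsumT
  have hD : HasSum (fun n => (a n - a (n + 1)) / 2) (b ^ (-σ) / 2) := by
    rw [hsumD.hasSum_iff_tendsto_nat]
    have hpart : ∀ N, ∑ i ∈ Finset.range N, (a i - a (i + 1)) / 2 = (a 0 - a N) / 2 := by
      intro N
      rw [← Finset.sum_div, Finset.sum_range_sub']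
    simp_rw [hpart]
    have ha0 : a 0 = b ^ (-σ) := by simp [ha]
    rw [← ha0]
    have hlim := ((tendsto_const_nhds (x := a 0)).sub
      (tendsto_natCast_add_cpow_neg hb hσ)).div_const 2
    rw [sub_zero] at hlim
    exact hlim
  calc hurwitzR σ b = ∑' n, (hurwitzZetaCTerm σ b n - (a n - a (n + 1)) / 2) := by
        rw [hurwitzR_def]; exact tsum_congr hdiff
    _ = ∑' n, hurwitzZetaCTerm σ b n - ∑' n, (a n - a (n + 1)) / 2 := hsumZ.tsum_sub hsumD
    _ = (hurwitzZetaC σ b - b ^ (1 - σ) / (σ - 1)) - b ^ (-σ) / 2 := by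
        rw [hD.tsum_eq, hurwitzZetaC_def, add_sub_cancel_right]
    _ = _ := by ring

/-- The Dirichlet-type series `∑ₙ (n+b)^{-σ}` converges absolutely for `Re σ > 1`, `Re b > 0`. [folklore] -/
theorem summable_natCast_add_cpow_neg {σ b : ℂ} (hσ : 1 < σ.re) (hb : 0 < b.re) :
    Summable fun n : ℕ => ((n : ℂ) + b) ^ (-σ) := by
  have h := (summable_nat_add_rpow_neg (σ := σ.re - 1) hb (by linarith)).mul_left
    (Real.exp (π / 2 * |σ.im|))
  refine Summable.of_norm_bounded h fun n => ?_
  have := norm_natCast_add_cpow_neg_le hb (by linarith : 0 ≤ σ.re) n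
  convert this using 3
  ring

/-- **Evaluation for `Re σ > 1`**: `R(σ, b) = ∑_{n ≥ 0} (n+b)^{-σ} - b^{1-σ}/(σ-1) - b^{-σ}/2`
(`Re b > 0`). The partial sums of the trapezoid series are
`∑_{n<N} (n+b)^{-σ} - b^{-σ}/2 + (N+b)^{-σ}/2 - ((N+b)^{1-σ} - b^{1-σ})/(1-σ)`. [folklore] -/
theorem hurwitzR_eq_tsum_sub {σ b : ℂ} (hσ : 1 < σ.re) (hb : 0 < b.re) :
    hurwitzR σ b = ∑' n : ℕ, ((n : ℂ) + b) ^ (-σ) - b ^ (1 - σ) / (σ - 1) - b ^ (-σ) / 2 := by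
  have hσ1 : σ ≠ 1 := fun h => by rw [h, one_re] at hσ; exact lt_irrefl _ hσ
  have h1s : (1 - σ) ≠ 0 := sub_ne_zero.mpr hσ1.symm
  set a : ℕ → ℂ := fun n => ((n : ℂ) + b) ^ (-σ) with ha
  set B : ℕ → ℂ := fun n => ((n : ℂ) + b) ^ (1 - σ) / (1 - σ) with hB
  have hsumT := summable_hurwitzTrapTerm hσ1 (by linarith) hb
  have hsumA : Summable a := summable_natCast_add_cpow_neg hσ hb
  -- partial sums
  have ht : ∀ N : ℕ, hurwitzTrapTerm σ b N = (a N + a (N + 1)) / 2 - (B (N + 1) - B N) := by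
    intro N
    simp only [ha, hB, hurwitzTrapTerm, Nat.cast_succ]
    ring_nf
  have hpart : ∀ N, ∑ i ∈ Finset.range N, hurwitzTrapTerm σ b i =
      ∑ i ∈ Finset.range N, a i - a 0 / 2 + a N / 2 - (B N - B 0) := by
    intro N
    induction N with
    | zero => simp
    | succ N ih =>
      rw [Finset.sum_range_succ, ih, Finset.sum_range_succ, ht N]
      ring
  have hT : HasSum (hurwitzTrapTerm σ b) (∑' n, a n - a 0 / 2 + 0 / 2 - (0 - B 0)) := by
    rw [hsumT.hasSum_iff_tendsto_nat]
    simp_rw [hpart]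
    refine ((hsumA.hasSum.tendsto_sum_nat.sub_const _).add ?_).sub (Tendsto.sub_const ?_ _)
    · exact (tendsto_natCast_add_cpow_neg hb (by linarith)).div_const 2
    · simp only [hB]
      have h := (tendsto_natCast_add_cpow_neg (τ := -(1 - σ)) hb
        (by simp only [neg_re, sub_re, one_re]; linarith)).div_const (1 - σ)
      simp only [neg_neg, zero_div] at h
      exact h
  rw [hurwitzR_def, hT.tsum_eq]
  simp only [ha, hB, Nat.cast_zero, zero_add]
  field_simp
  ring

/-! ### Decay in the parameter -/

/-- Splitting the exponent: for `0 < x₀ ≤ x` and `s > 0`,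
`∑ₙ (n+x)^{-(s+2)} ≤ x^{-(s/2+1)} ∑ₙ (n+x₀)^{-(s/2+1)}` (each term is the product of two factors
`(n+x)^{-(s/2+1)}`, bounded by `x^{-(s/2+1)}` and by `(n+x₀)^{-(s/2+1)}` respectively). [folklore] -/
theorem tsum_nat_add_rpow_neg_two_le {x x₀ s : ℝ} (hx₀ : 0 < x₀) (hx : x₀ ≤ x) (hs : 0 < s) :
    ∑' n : ℕ, ((n : ℝ) + x) ^ (-(s + 2)) ≤
      x ^ (-(s / 2 + 1)) * ∑' n : ℕ, ((n : ℝ) + x₀) ^ (-(s / 2 + 1)) := by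
  have hxpos : 0 < x := hx₀.trans_le hx
  rw [← tsum_mul_left]
  refine Summable.tsum_le_tsum (fun n => ?_) (summable_nat_add_rpow_neg_two hxpos (by linarith))
    ((summable_nat_add_rpow_neg hx₀ (by linarith : 0 < s / 2)).mul_left _)
  have hn : 0 < (n : ℝ) + x := by positivity
  have hsplit : ((n : ℝ) + x) ^ (-(s + 2)) =
      ((n : ℝ) + x) ^ (-(s / 2 + 1)) * ((n : ℝ) + x) ^ (-(s / 2 + 1)) := by
    rw [← Real.rpow_add hn]; ring_nf
  rw [hsplit]
  refine mul_le_mul ?_ ?_ (Real.rpow_nonneg hn.le _) (Real.rpow_nonneg hxpos.le _)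
  · exact Real.rpow_le_rpow_of_nonpos hxpos (by linarith [n.cast_nonneg (α := ℝ)]) (by linarith)
  · exact Real.rpow_le_rpow_of_nonpos (by positivity) (by linarith) (by linarith)

/-- **Decay of the remainder**: for `σ ≠ 1`, `Re σ > 0` and `0 < x₀ ≤ Re b`,
`‖R(σ, b)‖ ≤ K(σ) (Re b)^{-(Re σ/2 + 1)} ∑ₙ (n+x₀)^{-(Re σ/2+1)}` — in particular
`R(σ, b) = O((Re b)^{-(Re σ/2+1)})` uniformly on `{Re b ≥ x₀}`, which is summable along `b = m v`
and tends to `0` as `Re b → ∞`. [folklore] -/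
theorem norm_hurwitzR_le_decay {σ b : ℂ} {x₀ : ℝ} (hσ1 : σ ≠ 1) (hσ : 0 < σ.re) (hx₀ : 0 < x₀)
    (hb : x₀ ≤ b.re) :
    ‖hurwitzR σ b‖ ≤ trapConst σ * b.re ^ (-(σ.re / 2 + 1)) *
      ∑' n : ℕ, ((n : ℝ) + x₀) ^ (-(σ.re / 2 + 1)) := by
  have hb0 : 0 < b.re := hx₀.trans_le hb
  refine (norm_hurwitzR_le_tsum hσ1 (by linarith) hb0).trans ?_
  rw [mul_assoc]
  exact mul_le_mul_of_nonneg_left (tsum_nat_add_rpow_neg_two_le hx₀ hb hσ) (trapConst_nonneg σ)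

/-- **Uniform decay** for `σ` in a box: if `0 < s₁ ≤ Re σ ≤ s₂`, `‖σ‖ ≤ S`, `|Im σ| ≤ T`, `σ ≠ 1`
and `0 < x₀ ≤ Re b`, then
`‖R(σ,b)‖ ≤ S(S+1)e^{πT/2}/2 · ((Re b)^{-(s₁/2+1)} + (Re b)^{-(s₂/2+1)}) · (Z(x₀,s₁) + Z(x₀,s₂))`,
`Z(x₀,s) = ∑ₙ (n+x₀)^{-(s/2+1)}`. [folklore] -/
theorem norm_hurwitzR_le_uniform {σ b : ℂ} {s₁ s₂ S T x₀ : ℝ} (hσ1 : σ ≠ 1) (h₁ : s₁ ≤ σ.re)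
    (h₂ : σ.re ≤ s₂) (hs₁ : 0 < s₁) (hS : ‖σ‖ ≤ S) (hT : |σ.im| ≤ T) (hx₀ : 0 < x₀)
    (hb : x₀ ≤ b.re) :
    ‖hurwitzR σ b‖ ≤ S * (S + 1) * Real.exp (π / 2 * T) / 2 *
      (b.re ^ (-(s₁ / 2 + 1)) + b.re ^ (-(s₂ / 2 + 1))) *
      ((∑' n : ℕ, ((n : ℝ) + x₀) ^ (-(s₁ / 2 + 1))) + ∑' n : ℕ, ((n : ℝ) + x₀) ^ (-(s₂ / 2 + 1))) := by
  have hb0 : 0 < b.re := hx₀.trans_le hb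
  have hs₂ : 0 < s₂ := hs₁.trans_le (h₁.trans h₂)
  set KV : ℝ := S * (S + 1) * Real.exp (π / 2 * T) / 2 with hKV
  have hKV0 : 0 ≤ KV := by
    have hS0 : 0 ≤ S := (norm_nonneg _).trans hS
    positivity
  set Z₁ : ℝ := ∑' n : ℕ, ((n : ℝ) + x₀) ^ (-(s₁ / 2 + 1)) with hZ₁
  set Z₂ : ℝ := ∑' n : ℕ, ((n : ℝ) + x₀) ^ (-(s₂ / 2 + 1)) with hZ₂
  set A₁ : ℝ := b.re ^ (-(s₁ / 2 + 1)) with hA₁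
  set A₂ : ℝ := b.re ^ (-(s₂ / 2 + 1)) with hA₂
  have hZ₁0 : 0 ≤ Z₁ := tsum_nonneg fun n => Real.rpow_nonneg (by positivity) _
  have hZ₂0 : 0 ≤ Z₂ := tsum_nonneg fun n => Real.rpow_nonneg (by positivity) _
  have hA₁0 : 0 ≤ A₁ := Real.rpow_nonneg hb0.le _
  have hA₂0 : 0 ≤ A₂ := Real.rpow_nonneg hb0.le _
  -- termwise bound with `x₀ := Re b`, summed
  have hsum₁ := summable_nat_add_rpow_neg_two hb0 (by linarith : (-1 : ℝ) < s₁)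
  have hsum₂ := summable_nat_add_rpow_neg_two hb0 (by linarith : (-1 : ℝ) < s₂)
  have h1 : ‖hurwitzR σ b‖ ≤ KV * ((∑' n : ℕ, ((n : ℝ) + b.re) ^ (-(s₁ + 2))) +
      ∑' n : ℕ, ((n : ℝ) + b.re) ^ (-(s₂ + 2))) := by
    rw [hurwitzR_def, ← (hsum₁.tsum_add hsum₂), ← tsum_mul_left]
    refine tsum_of_norm_bounded ((hsum₁.add hsum₂).mul_left KV).hasSum fun n => ?_
    exact norm_hurwitzTrapTerm_le_uniform hσ1 h₁ h₂ (by linarith) hS hT hb0 le_rfl n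
  have h2 : (∑' n : ℕ, ((n : ℝ) + b.re) ^ (-(s₁ + 2))) ≤ A₁ * Z₁ :=
    tsum_nat_add_rpow_neg_two_le hx₀ hb hs₁
  have h3 : (∑' n : ℕ, ((n : ℝ) + b.re) ^ (-(s₂ + 2))) ≤ A₂ * Z₂ :=
    tsum_nat_add_rpow_neg_two_le hx₀ hb hs₂
  have h4 : A₁ * Z₁ + A₂ * Z₂ ≤ (A₁ + A₂) * (Z₁ + Z₂) := by nlinarith
  calc ‖hurwitzR σ b‖ ≤ KV * (A₁ * Z₁ + A₂ * Z₂) :=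
        h1.trans (mul_le_mul_of_nonneg_left (add_le_add h2 h3) hKV0)
    _ ≤ KV * ((A₁ + A₂) * (Z₁ + Z₂)) := mul_le_mul_of_nonneg_left h4 hKV0
    _ = KV * (A₁ + A₂) * (Z₁ + Z₂) := by ring

/-! ### Holomorphy in the parameter `b` -/

/-- Each trapezoid bracket is holomorphic in `b` on the right half-plane. [folklore] -/
theorem differentiableOn_hurwitzTrapTerm_right (σ : ℂ) (n : ℕ) :
    DifferentiableOn ℂ (fun b => hurwitzTrapTerm σ b n) {b : ℂ | 0 < b.re} := by
  have hslit : ∀ b ∈ {b : ℂ | 0 < b.re}, (n : ℂ) + b ∈ slitPlane := fun b hb => by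
    refine mem_slitPlane_iff.mpr (Or.inl ?_)
    have hb' : (0 : ℝ) < b.re := hb
    simp only [add_re, natCast_re]
    positivity
  have hslit1 : ∀ b ∈ {b : ℂ | 0 < b.re}, (n : ℂ) + b + 1 ∈ slitPlane := fun b hb => by
    refine mem_slitPlane_iff.mpr (Or.inl ?_)
    have hb' : (0 : ℝ) < b.re := hb
    simp only [add_re, natCast_re, one_re]
    positivity
  have hB : DifferentiableOn ℂ (fun b : ℂ => (n : ℂ) + b) {b : ℂ | 0 < b.re} :=
    (differentiableOn_const _).add differentiableOn_id
  have hB1 : DifferentiableOn ℂ (fun b : ℂ => (n : ℂ) + b + 1) {b : ℂ | 0 < b.re} :=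
    hB.add_const 1
  unfold hurwitzTrapTerm
  exact (((hB.cpow_const hslit).add (hB1.cpow_const hslit1)).div_const _).sub
    (((hB1.cpow_const hslit1).sub (hB.cpow_const hslit)).div_const _)

/-- `b ↦ R(σ, b)` is holomorphic on `{Re b > δ}` for every `δ > 0` (M-test), `Re σ > -1`, `σ ≠ 1`.
[folklore] -/
theorem differentiableOn_hurwitzR_right_of_lt {σ : ℂ} {δ : ℝ} (hσ1 : σ ≠ 1) (hσ : -1 < σ.re)
    (hδ : 0 < δ) : DifferentiableOn ℂ (hurwitzR σ) {b : ℂ | δ < b.re} := by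
  have hopen : IsOpen {b : ℂ | δ < b.re} := isOpen_lt continuous_const Complex.continuous_re
  have h : (hurwitzR σ) = fun b => ∑' n, hurwitzTrapTerm σ b n := rfl
  rw [h]
  refine Complex.differentiableOn_tsum_of_summable_norm
    ((summable_nat_add_rpow_neg_two hδ hσ).mul_left (trapConst σ))
    (fun n => (differentiableOn_hurwitzTrapTerm_right σ n).mono fun b hb => hδ.trans hb) hopen ?_
  intro n b hb
  have hb' : δ < b.re := hb
  refine (norm_hurwitzTrapTerm_le hσ1 (by linarith) (hδ.trans hb') n).trans ?_
  refine mul_le_mul_of_nonneg_left ?_ (trapConst_nonneg σ)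
  exact Real.rpow_le_rpow_of_nonpos (by positivity) (by linarith) (by linarith)

/-- **Holomorphy of `b ↦ R(σ, b)` on the right half-plane** (`Re σ > -1`, `σ ≠ 1`). [folklore] -/
theorem differentiableOn_hurwitzR_right {σ : ℂ} (hσ1 : σ ≠ 1) (hσ : -1 < σ.re) :
    DifferentiableOn ℂ (hurwitzR σ) {b : ℂ | 0 < b.re} := by
  intro b hb
  have hb' : (0 : ℝ) < b.re := hb
  have hmem : b ∈ {c : ℂ | b.re / 2 < c.re} := by
    show b.re / 2 < b.re
    linarith
  have hopen : IsOpen {c : ℂ | b.re / 2 < c.re} := isOpen_lt continuous_const Complex.continuous_re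
  exact ((differentiableOn_hurwitzR_right_of_lt hσ1 hσ (by positivity : 0 < b.re / 2)).differentiableAt
    (hopen.mem_nhds hmem)).differentiableWithinAt

/-! ### Holomorphy in the exponent `σ` -/

/-- Each trapezoid bracket is holomorphic in `σ` away from `σ = 1` (`Re b > 0`). [folklore] -/
theorem differentiableAt_hurwitzTrapTerm_left {b : ℂ} (hb : 0 < b.re) (n : ℕ) {σ : ℂ} (hσ1 : σ ≠ 1) :
    DifferentiableAt ℂ (fun τ => hurwitzTrapTerm τ b n) σ := by
  have h0 : (n : ℂ) + b ≠ 0 := fun h => by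
    have := congrArg Complex.re h
    simp only [add_re, natCast_re, zero_re] at this
    linarith [n.cast_nonneg (α := ℝ)]
  have h1 : (n : ℂ) + b + 1 ≠ 0 := fun h => by
    have := congrArg Complex.re h
    simp only [add_re, natCast_re, one_re, zero_re] at this
    linarith [n.cast_nonneg (α := ℝ)]
  have hA : DifferentiableAt ℂ (fun τ : ℂ => ((n : ℂ) + b) ^ (-τ)) σ :=
    differentiableAt_id.neg.const_cpow (Or.inl h0)
  have hB : DifferentiableAt ℂ (fun τ : ℂ => ((n : ℂ) + b + 1) ^ (-τ)) σ :=
    differentiableAt_id.neg.const_cpow (Or.inl h1)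
  have hC : DifferentiableAt ℂ (fun τ : ℂ => ((n : ℂ) + b + 1) ^ (1 - τ)) σ :=
    (differentiableAt_id.const_sub 1).const_cpow (Or.inl h1)
  have hD : DifferentiableAt ℂ (fun τ : ℂ => ((n : ℂ) + b) ^ (1 - τ)) σ :=
    (differentiableAt_id.const_sub 1).const_cpow (Or.inl h0)
  unfold hurwitzTrapTerm
  exact ((hA.add hB).div_const _).sub ((hC.sub hD).div (differentiableAt_id.const_sub 1)
    (sub_ne_zero.mpr hσ1.symm))

/-- **Bounds on a small ball** around `σ₀`: if `r ≤ Re σ₀ / 2` and `r ≤ ‖σ₀ - 1‖ / 2` then every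
`σ ∈ ball σ₀ r` satisfies `Re σ₀/2 ≤ Re σ ≤ Re σ₀ + r`, `‖σ‖ ≤ ‖σ₀‖ + r`, `|Im σ| ≤ |Im σ₀| + r` and
`σ ≠ 1` (used for local M-tests in the exponent). [folklore] -/
theorem ball_bounds {σ₀ σ : ℂ} {r : ℝ} (hr1 : r ≤ σ₀.re / 2) (hr2 : r ≤ ‖σ₀ - 1‖ / 2)
    (hσV : σ ∈ ball σ₀ r) :
    σ₀.re / 2 ≤ σ.re ∧ σ.re ≤ σ₀.re + r ∧ ‖σ‖ ≤ ‖σ₀‖ + r ∧ |σ.im| ≤ |σ₀.im| + r ∧ σ ≠ 1 := by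
  have h : ‖σ - σ₀‖ < r := mem_ball_iff_norm.mp hσV
  have hre := (abs_re_le_norm (σ - σ₀)).trans h.le
  rw [sub_re, abs_le] at hre
  have him := (abs_im_le_norm (σ - σ₀)).trans h.le
  rw [sub_im] at him
  have him' := abs_sub_abs_le_abs_sub σ.im σ₀.im
  have hn := norm_le_norm_add_norm_sub' σ σ₀
  refine ⟨by linarith [hre.1], by linarith [hre.2], by linarith, by linarith, fun h1 => ?_⟩
  rw [h1, norm_sub_rev] at h
  have : 0 ≤ ‖σ₀ - 1‖ := norm_nonneg _
  linarith

/-- **Holomorphy of `σ ↦ R(σ, b)`** at every `σ₀` with `Re σ₀ > 0`, `σ₀ ≠ 1` (`Re b > 0` fixed):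
local M-test on a small ball around `σ₀` with the uniform term estimate. [folklore] -/
theorem differentiableAt_hurwitzR_left {b : ℂ} (hb : 0 < b.re) {σ₀ : ℂ} (hσ1 : σ₀ ≠ 1)
    (hσ : 0 < σ₀.re) : DifferentiableAt ℂ (fun σ => hurwitzR σ b) σ₀ := by
  have hd1 : 0 < ‖σ₀ - 1‖ := norm_pos_iff.mpr (sub_ne_zero.mpr hσ1)
  set r : ℝ := min (σ₀.re / 2) (‖σ₀ - 1‖ / 2) with hr
  have hr0 : 0 < r := lt_min (by positivity) (by positivity)
  have hr1 : r ≤ σ₀.re / 2 := min_le_left _ _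
  have hr2 : r ≤ ‖σ₀ - 1‖ / 2 := min_le_right _ _
  -- the M-test on `ball σ₀ r`
  set s₁ : ℝ := σ₀.re / 2 with hs₁
  set s₂ : ℝ := σ₀.re + r with hs₂
  set S : ℝ := ‖σ₀‖ + r with hS
  set T : ℝ := |σ₀.im| + r with hT
  have hs₁0 : 0 < s₁ := by rw [hs₁]; positivity
  have hs₂0 : 0 < s₂ := by rw [hs₂]; positivity
  have hsum : Summable fun n : ℕ => S * (S + 1) * Real.exp (π / 2 * T) / 2 *
      (((n : ℝ) + b.re) ^ (-(s₁ + 2)) + ((n : ℝ) + b.re) ^ (-(s₂ + 2))) :=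
    ((summable_nat_add_rpow_neg_two hb (by linarith : (-1 : ℝ) < s₁)).add
      (summable_nat_add_rpow_neg_two hb (by linarith : (-1 : ℝ) < s₂))).mul_left _
  have hdiff : DifferentiableOn ℂ (fun σ => ∑' n, hurwitzTrapTerm σ b n) (ball σ₀ r) := by
    refine Complex.differentiableOn_tsum_of_summable_norm hsum
      (fun n σ hσV => (differentiableAt_hurwitzTrapTerm_left hb n
        (ball_bounds hr1 hr2 hσV).2.2.2.2).differentiableWithinAt)
      isOpen_ball ?_
    intro n σ hσV
    obtain ⟨h₁, h₂, h₃, h₄, h₅⟩ := ball_bounds hr1 hr2 hσV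
    exact norm_hurwitzTrapTerm_le_uniform h₅ h₁ h₂ (by linarith) h₃ h₄ hb le_rfl n
  exact hdiff.differentiableAt (isOpen_ball.mem_nhds (mem_ball_self hr0))

/-! ### Sharp decay `R(σ, b) = O((Re b)^{-(Re σ+1)})` by integral comparison -/

/-- **Integral comparison**: `∑ₙ (n + x)^{-p} ≤ x^{-p} + x^{1-p}/(p-1)` for `p > 1`, `x > 0`
(the terms `n ≥ 1` are compared with `∫ₓ^∞ t^{-p} dt = x^{1-p}/(p-1)`). [folklore] -/
theorem tsum_nat_add_rpow_neg_le_integral {x p : ℝ} (hx : 0 < x) (hp : 1 < p) :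
    ∑' n : ℕ, ((n : ℝ) + x) ^ (-p) ≤ x ^ (-p) + x ^ (1 - p) / (p - 1) := by
  have hnn : ∀ n : ℕ, 0 ≤ ((n : ℝ) + x) ^ (-p) := fun n => Real.rpow_nonneg (by positivity) _
  have hR : 0 ≤ x ^ (1 - p) / (p - 1) := div_nonneg (Real.rpow_nonneg hx.le _) (by linarith)
  refine Real.tsum_le_of_sum_range_le hnn fun N => ?_
  cases N with
  | zero => simpa using add_nonneg (Real.rpow_nonneg hx.le _) hR
  | succ a =>
    rw [Finset.sum_range_succ']
    simp only [Nat.cast_zero, zero_add]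
    rw [add_comm]
    refine add_le_add le_rfl ?_
    -- the antitone comparison `∑_{i<a} (x + (i+1))^{-p} ≤ ∫ₓ^{x+a} t^{-p} dt`
    have hanti : AntitoneOn (fun t : ℝ => t ^ (-p)) (Icc x (x + a)) := by
      intro u hu v _ huv
      exact Real.rpow_le_rpow_of_nonpos (hx.trans_le hu.1) huv (by linarith)
    have hcmp := AntitoneOn.sum_le_integral hanti
    have hint : ∫ t in x..x + a, t ^ (-p) = ((x + a) ^ (-p + 1) - x ^ (-p + 1)) / (-p + 1) :=
      integral_rpow (Or.inr ⟨by linarith, notMem_uIcc_of_lt hx (by positivity)⟩)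
    have hsum : ∑ i ∈ Finset.range a, (((i + 1 : ℕ) : ℝ) + x) ^ (-p) =
        ∑ i ∈ Finset.range a, (x + ((i + 1 : ℕ) : ℝ)) ^ (-p) :=
      Finset.sum_congr rfl fun i _ => by rw [add_comm]
    rw [hsum]
    refine hcmp.trans ?_
    rw [hint]
    have hxa : 0 ≤ (x + a) ^ (1 - p) := Real.rpow_nonneg (by positivity) _
    have e1 : (-p + 1) = 1 - p := by ring
    have e2 : ((x + a) ^ (1 - p) - x ^ (1 - p)) / (1 - p) = (x ^ (1 - p) - (x + a) ^ (1 - p)) / (p - 1) := by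
      rw [div_eq_div_iff (by linarith) (by linarith)]
      ring
    rw [e1, e2]
    exact div_le_div_of_nonneg_right (by linarith) (by linarith)

/-- **Sharp norm bound**: `‖R(σ, b)‖ ≤ K(σ) ((Re b)^{-(Re σ+2)} + (Re b)^{-(Re σ+1)}/(Re σ+1))` for
`σ ≠ 1`, `Re σ > -1`, `Re b > 0` (`norm_hurwitzR_le_tsum` + integral comparison). [folklore] -/
theorem norm_hurwitzR_le_sharp {σ b : ℂ} (hσ1 : σ ≠ 1) (hσ : -1 < σ.re) (hb : 0 < b.re) :
    ‖hurwitzR σ b‖ ≤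
      trapConst σ * (b.re ^ (-(σ.re + 2)) + b.re ^ (-(σ.re + 1)) / (σ.re + 1)) := by
  refine (norm_hurwitzR_le_tsum hσ1 hσ hb).trans (mul_le_mul_of_nonneg_left ?_ (trapConst_nonneg σ))
  have h := tsum_nat_add_rpow_neg_le_integral hb (by linarith : 1 < σ.re + 2)
  have e1 : (1 - (σ.re + 2)) = -(σ.re + 1) := by ring
  have e2 : (σ.re + 2 - 1) = σ.re + 1 := by ring
  rw [e1, e2] at h
  exact h

/-- **Decay of the remainder, sharp order**: for `σ ≠ 1`, `Re σ > -1` and `0 < x₀ ≤ Re b`,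
`‖R(σ, b)‖ ≤ K(σ) (1/x₀ + 1/(Re σ+1)) (Re b)^{-(Re σ+1)}`, i.e. `R(σ, b) = O((Re b)^{-(Re σ+1)})`
uniformly on `{Re b ≥ x₀}` — one order better than `ζ(σ, b) - b^{1-σ}/(σ-1) = O((Re b)^{-Re σ})`,
and valid on the larger range `Re σ > -1` (compare `norm_hurwitzR_le_decay`). [folklore] -/
theorem norm_hurwitzR_le_decay_sharp {σ b : ℂ} {x₀ : ℝ} (hσ1 : σ ≠ 1) (hσ : -1 < σ.re)
    (hx₀ : 0 < x₀) (hb : x₀ ≤ b.re) :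
    ‖hurwitzR σ b‖ ≤ trapConst σ * (1 / x₀ + 1 / (σ.re + 1)) * b.re ^ (-(σ.re + 1)) := by
  have hb0 : 0 < b.re := hx₀.trans_le hb
  refine (norm_hurwitzR_le_sharp hσ1 hσ hb0).trans ?_
  rw [mul_assoc]
  refine mul_le_mul_of_nonneg_left ?_ (trapConst_nonneg σ)
  have hA : 0 ≤ b.re ^ (-(σ.re + 1)) := Real.rpow_nonneg hb0.le _
  have hs1 : 0 < σ.re + 1 := by linarith
  have h1 : b.re ^ (-(σ.re + 2)) = b.re ^ (-(σ.re + 1)) * b.re⁻¹ := by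
    rw [← Real.rpow_neg_one, ← Real.rpow_add hb0]
    congr 1
    ring
  have h2 : b.re⁻¹ ≤ 1 / x₀ := by
    rw [one_div]
    exact inv_anti₀ hx₀ hb
  calc b.re ^ (-(σ.re + 2)) + b.re ^ (-(σ.re + 1)) / (σ.re + 1)
      = b.re ^ (-(σ.re + 1)) * (b.re⁻¹ + 1 / (σ.re + 1)) := by rw [h1]; ring
    _ ≤ b.re ^ (-(σ.re + 1)) * (1 / x₀ + 1 / (σ.re + 1)) :=
        mul_le_mul_of_nonneg_left (add_le_add h2 le_rfl) hA
    _ = (1 / x₀ + 1 / (σ.re + 1)) * b.re ^ (-(σ.re + 1)) := mul_comm _ _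

/-- In particular `R(σ, b) → 0` as `Re b → ∞` at the rate `(Re b)^{-(Re σ+1)}`: for `Re b ≥ 1`,
`‖R(σ, b)‖ ≤ K(σ) (1 + 1/(Re σ+1)) (Re b)^{-(Re σ+1)}` (`σ ≠ 1`, `Re σ > -1`). [folklore] -/
theorem norm_hurwitzR_le_of_one_le_re {σ b : ℂ} (hσ1 : σ ≠ 1) (hσ : -1 < σ.re) (hb : 1 ≤ b.re) :
    ‖hurwitzR σ b‖ ≤ trapConst σ * (1 + 1 / (σ.re + 1)) * b.re ^ (-(σ.re + 1)) := by
  simpa using norm_hurwitzR_le_decay_sharp hσ1 hσ one_pos hb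

end Literature.Dynamics.TransferOperators
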